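import Literature.MathematicalPhysics.QuantumLattice.HubbardUVShiftedSymbolDifferences
import Literature.MathematicalPhysics.QuantumLattice.HubbardGridSliceRowSum
import HarnessLib

/-!
# The `L¹` norm (row sums) of the block above the infrared scale on the time grid: `α_0 ≤ C·(N/β)`, uniform in `M ≥ M₀(β)` and `L`

Topic `MathematicalPhysics/QuantumLattice`; cell gate-hubbard-kl, R0-SCOPE-4 W2e-c: the hypotheses `hrow`/`hcol` of
`GrassmannEffectiveActionBoundDB` / `GrassmannFlowDBRefined` for the FIRST covariance of the shifted decomposition, `top + uv = w_{Λ₀}·p_θ`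
pulled back to the `N`-point time grid — the `θ ≠ 0` twin of `HubbardUVCovarianceCTDecayBound` and the scale-`0` companion of
`HubbardGridSliceRowSum`.  Assembly of `HubbardGridCharacters.sum_norm_gridSub_pullback_row_le/col_le`,
`TorusFourierWeightedL1Prod.sum_sum_norm_prodChar_le` (additive quartic weight, time rate `s₀ = Λ₀β/N`, space rate `Λ₀`),
`TorusAdditiveWeightSum.sum_inv_additiveWeight_le` and the three `ℓ²` sums of `HubbardUVShiftedSymbolDifferences`; the only place where
the Matsubara cutoff `M` is seen is the edge term, which is `O((Λ₀β)⁴/M²)` and is dominated under `(Λ₀β)⁵ ≤ (2M-3)²`.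

* **`exists_rowSum_uvShifted_le`** — for `0 < Λ₀ ≤ 1` there is `C > 0` with: for all `L, M, N, β, μ, θ` with `0 < β`, `|βθ| ≤ π/4`,
  `π/β ≤ Λ₀`, `4π/β ≤ Λ₀`, `2 ≤ M`, `2M ≤ N`, `Λ₀β ≤ N`, `(Λ₀β)⁵ ≤ (2M-3)²`, every row and column sum of `Sᵀ (top + uv) S` over the grid
  legs is at most `C·(N/β)` (BGM (2.81) at `γ^h = Λ₀ = O(1)`: the UV propagator has an `O(1)` `L¹` norm per unit `β/N` of grid weight).

Everything is proved; no definitions, no named facts.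

## Sources

G. Benfatto, A. Giuliani, V. Mastropietro, Ann. Henri Poincaré 7 (2006) 809–898, §2.8 (2.80)–(2.81), App. A1 (`BenfattoGiulianiMastropietro2006`);
W. de Siqueira Pedra, M. Salmhofer, Comm. Math. Phys. 282 (2008) 797–818, §4 Cor. 4.4 (`PedraSalmhofer2008`).
-/

noncomputable section

namespace Literature.MathematicalPhysics.QuantumLattice

open Literature.Probability.LatticeModels Finset Complex GrassmannAlgebra

/-- Arithmetic of the interior time term. [folklore] -/
private theorem interior_time_eq {Λ₀ β L K₅ : ℝ} (hΛ₀ : 0 < Λ₀) (hβ : 0 < β) (hL : 0 < L) :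
    (Λ₀ * β / 4) ^ 4 * (L ^ 2 * (((1 / (β * L ^ 2)) ^ 2) ^ 2 * (2 * Real.pi / β) ^ 4 *
        (K₅ * (β * L ^ 2) / Λ₀) ^ 2 * (β / (2 * Λ₀ ^ 3)))) = (2 * Real.pi) ^ 4 * K₅ ^ 2 / 512 / (β * L ^ 2 * Λ₀) := by
  field_simp
  ring

/-- Arithmetic of the edge term under `(Λ₀β)⁵ ≤ (2M-3)²`. [folklore] -/
private theorem edge_time_le {Λ₀ β L m : ℝ} (hΛ₀ : 0 < Λ₀) (hβ : 0 < β) (hL : 0 < L) (hm : 0 < m) (hMβ : (Λ₀ * β) ^ 5 ≤ m ^ 2) :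
    (Λ₀ * β / 4) ^ 4 * (4 * (L ^ 2 * (4 * ((1 / (β * L ^ 2)) ^ 2 * (5 * (β * L ^ 2) * (β / (Real.pi * m))))) ^ 2)) ≤
      1 / (β * L ^ 2 * Λ₀) := by
  have hπ : (3 : ℝ) ≤ Real.pi := by linarith [Real.pi_gt_three]
  rw [show (Λ₀ * β / 4) ^ 4 * (4 * (L ^ 2 * (4 * ((1 / (β * L ^ 2)) ^ 2 * (5 * (β * L ^ 2) * (β / (Real.pi * m))))) ^ 2)) =
      (25 / 4) * ((Λ₀ * β) ^ 4 / (Real.pi ^ 2 * m ^ 2)) / L ^ 2 by field_simp; ring]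
  rw [div_le_div_iff₀ (by positivity) (by positivity)]
  have h1 : (Λ₀ * β) ^ 4 * (β * Λ₀) = (Λ₀ * β) ^ 5 := by ring
  have h9 : (9 : ℝ) ≤ Real.pi ^ 2 := by nlinarith [hπ]
  have h2 : 25 / 4 * (Λ₀ * β) ^ 5 ≤ Real.pi ^ 2 * m ^ 2 := by
    have := mul_le_mul_of_nonneg_right h9 (sq_nonneg m)
    nlinarith [hMβ, pow_nonneg (mul_pos hΛ₀ hβ).le 5, this]
  have hL2 : (0 : ℝ) < L ^ 2 := by positivity
  calc 25 / 4 * ((Λ₀ * β) ^ 4 / (Real.pi ^ 2 * m ^ 2)) * (β * L ^ 2 * Λ₀)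
      = (25 / 4 * (Λ₀ * β) ^ 5) / (Real.pi ^ 2 * m ^ 2) * L ^ 2 := by rw [← h1]; field_simp
    _ ≤ 1 * L ^ 2 := by
        refine mul_le_mul_of_nonneg_right ?_ hL2.le
        rw [div_le_one (by positivity)]; exact h2

/-- Arithmetic of the space term. [folklore] -/
private theorem space_eq {Λ₀ β L K' : ℝ} (hΛ₀ : 0 < Λ₀) (hβ : 0 < β) (hL : 0 < L) :
    (Λ₀ * L / 4) ^ 4 * (L ^ 2 * (((1 / (β * L ^ 2)) ^ 2) ^ 2 * (2 * Real.pi / L) ^ 4 *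
        (K' * (β * L ^ 2) / Λ₀) ^ 2 * (β / (2 * Λ₀ ^ 3)))) = ((2 * Real.pi) ^ 4 * K' ^ 2 / 512) / (β * L ^ 2 * Λ₀) := by
  field_simp
  ring

/-- Arithmetic of the plain `ℓ²` term. [folklore] -/
private theorem plain_eq {Λ₀ β L : ℝ} (hΛ₀ : 0 < Λ₀) (hβ : 0 < β) (hL : 0 < L) :
    L ^ 2 * (((1 / (β * L ^ 2)) ^ 2) ^ 2 * (20 * (β * L ^ 2) ^ 2) * (β / (2 * Λ₀))) = 10 / (β * L ^ 2 * Λ₀) := by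
  field_simp
  ring

/-- The final square-root assembly. [folklore] -/
private theorem sqrt_assembly {Λ₀ β N Q : ℝ} (hΛ₀ : 0 < Λ₀) (hβ : 0 < β) (hN : 0 < N) (hQ : 0 < Q) :
    Real.sqrt (2744 * N / (β * Λ₀ ^ 3)) * Real.sqrt (N * Q / (β * Λ₀)) = Real.sqrt (2744 * Q) / Λ₀ ^ 2 * (N / β) := by
  have hy : 0 ≤ N / β / Λ₀ ^ 2 := by positivity
  rw [← Real.sqrt_mul (by positivity),
    show Real.sqrt (2744 * Q) / Λ₀ ^ 2 * (N / β) = Real.sqrt (2744 * Q) * (N / β / Λ₀ ^ 2) by ring,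
    ← Real.sqrt_sq hy, ← Real.sqrt_mul (by positivity)]
  congr 1
  field_simp

/-- **The `L¹` norm of the block above the infrared scale on the grid**: for `0 < Λ₀ ≤ 1` there is `C > 0` such that for all
`L, M, N, β, μ, θ` with `0 < β`, `|βθ| ≤ π/4`, `π/β ≤ Λ₀`, `4π/β ≤ Λ₀`, `2 ≤ M`, `2M ≤ N`, `Λ₀β ≤ N`, `(Λ₀β)⁵ ≤ (2M-3)²`, every row and
every column sum of `Sᵀ (top + uv) S` over the grid legs is at most `C·(N/β)`. [cite: BenfattoGiulianiMastropietro2006, §2.8 (2.81)] -/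
theorem exists_rowSum_uvShifted_le {Λ₀ : ℝ} (hΛ₀ : 0 < Λ₀) (hΛ₀1 : Λ₀ ≤ 1) :
    ∃ C : ℝ, 0 < C ∧ ∀ (L M N : ℕ) [NeZero L] [NeZero N] (β μ θ : ℝ),
      0 < β → |β * θ| ≤ Real.pi / 4 → Real.pi / β ≤ Λ₀ → 2 * (2 * Real.pi / β) ≤ Λ₀ → 2 ≤ M → 2 * M ≤ N → Λ₀ * β ≤ N →
      (Λ₀ * β) ^ 5 ≤ (2 * (M : ℝ) - 3) ^ 2 →
      (∀ X : GridLeg (GridPoint L N), ∑ Y, ‖((hubbardGridSub L M β N).transpose *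
          (hubbardCovTopShifted L M β μ θ + hubbardCovUVShifted L M β μ θ Λ₀) * hubbardGridSub L M β N) X Y‖ ≤ C * (N / β)) ∧
      (∀ Y : GridLeg (GridPoint L N), ∑ X, ‖((hubbardGridSub L M β N).transpose *
          (hubbardCovTopShifted L M β μ θ + hubbardCovUVShifted L M β μ θ Λ₀) * hubbardGridSub L M β N) X Y‖ ≤ C * (N / β)) := by
  obtain ⟨B₁, B₂, hB₁0, hB₂0, hB₁, hB₂⟩ := exists_deriv_bounds_salmhoferCutoff
  -- the constants
  set K₅ : ℝ := 5 * (32 * B₂ + 144 * B₁ + 200) with hK₅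
  set K' : ℝ := 4 * (32 * B₂ + 144 * B₁ + 200) + 32 * B₁ + 40 with hK'
  set Qtot : ℝ := 11 + (2 * Real.pi) ^ 4 * (K₅ ^ 2 + 2 * K' ^ 2) / 512 with hQtot
  have hQtot0 : 0 < Qtot := by rw [hQtot]; positivity
  set C : ℝ := Real.sqrt (2744 * Qtot) / Λ₀ ^ 2 with hC
  have hC0 : 0 < C := by rw [hC]; positivity
  clear_value K₅ K' Qtot C
  refine ⟨C, hC0, ?_⟩
  intro L M N _ _ β μ θ hβ hθ hΛ₀β hstep hM2 hMN hNβ hMβ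
  have hL0 : (0 : ℝ) < L := by exact_mod_cast Nat.pos_of_ne_zero (NeZero.ne L)
  have hN0 : (0 : ℝ) < N := by exact_mod_cast Nat.pos_of_ne_zero (NeZero.ne N)
  have hM' : (0 : ℝ) < 2 * M - 3 := by
    have : (2 : ℝ) ≤ M := by exact_mod_cast hM2
    linarith
  -- the weight sum
  set s₀ : ℝ := Λ₀ * β / N with hs₀
  have hs₀0 : 0 < s₀ := by rw [hs₀]; positivity
  have hP : ∑ a : TorusSite 1 N, ∑ b : TorusSite 2 L,
      (1 + (s₀ * |(((a 0).valMinAbs : ℤ) : ℝ)|) ^ 4 + ∑ i, (Λ₀ * |(((b i).valMinAbs : ℤ) : ℝ)|) ^ 4)⁻¹ ≤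
        2744 * N / (β * Λ₀ ^ 3) := by
    refine (sum_inv_additiveWeight_le hs₀0 (fun _ : Fin 2 => Λ₀) fun _ => hΛ₀).trans ?_
    rw [Fin.prod_const]
    have h1 : 2 + 12 / s₀ ≤ 14 * N / (Λ₀ * β) := by
      have e1 : 12 / s₀ = 12 * N / (Λ₀ * β) := by rw [hs₀]; field_simp
      have e2 : (2 : ℝ) ≤ 2 * N / (Λ₀ * β) := by
        rw [le_div_iff₀ (by positivity)]; linarith only [hNβ]
      rw [e1]
      have e3 : 2 * N / (Λ₀ * β) + 12 * N / (Λ₀ * β) = 14 * N / (Λ₀ * β) := by ring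
      linarith only [e2, e3]
    have h2 : 2 + 12 / Λ₀ ≤ 14 / Λ₀ := by
      have e2 : (2 : ℝ) ≤ 2 / Λ₀ := by rw [le_div_iff₀ hΛ₀]; linarith only [hΛ₀1]
      have e3 : 2 / Λ₀ + 12 / Λ₀ = 14 / Λ₀ := by ring
      linarith only [e2, e3]
    calc (2 + 12 / s₀) * (2 + 12 / Λ₀) ^ 2 ≤ (14 * N / (Λ₀ * β)) * (14 / Λ₀) ^ 2 :=
          mul_le_mul h1 (pow_le_pow_left₀ (by positivity) h2 2) (by positivity) (by positivity)
      _ = 2744 * N / (β * Λ₀ ^ 3) := by field_simp; ring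
  -- the `ℓ¹` norm of the character sums, for each spin
  have hA : ∀ σ : Fin 2, ∑ a : TorusSite 1 N, ∑ bv : TorusSite 2 L,
      ‖∑ q₀ : TorusSite 1 N, ∑ qv : TorusSite 2 L, torusChar q₀ a * torusChar qv bv *
        gridSymbol L M N β (uvShiftedSymbol L M β μ θ Λ₀) σ q₀ qv‖ ≤ C * (N / β) := by
    intro σ
    have hE0 := sum_norm_sq_gridSymbol_uvShiftedSymbol_le (L := L) (M := M) (N := N) (μ := μ) hβ hθ hΛ₀β hMN σ
    have hE1 := sum_norm_sq_fwdDiff_two_time_uvShifted_le (L := L) (M := M) (N := N) (μ := μ) hβ hθ hΛ₀β hstep hB₁ hB₂ hM2 hMN σ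
    have hE2 := fun l : Fin 2 =>
      sum_norm_sq_fwdDiff_two_space_uvShifted_le (L := L) (M := M) (N := N) (μ := μ) hβ hθ hΛ₀β hΛ₀1 hB₁ hB₂ hMN σ l
    rw [← hK₅] at hE1
    simp only [← hK'] at hE2
    set G := gridSymbol L M N β (uvShiftedSymbol L M β μ θ Λ₀) σ with hG
    clear_value G
    have hmain := sum_sum_norm_prodChar_le (univ : Finset (Fin 2)) (fun _ : Fin 1 => (1 : ZMod N)) ((s₀ * N / 4) ^ 4)
      (by positivity) (fun i => (Pi.single i (1 : ZMod L) : TorusSite 2 L)) (fun _ => (Λ₀ * L / 4) ^ 4)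
      (fun _ _ => by positivity) 2 G
    simp_rw [weight_eq] at hmain
    refine hmain.trans ?_
    have hQ : ((N : ℝ) ^ 1 * (L : ℝ) ^ 2 *
        (∑ p, ∑ p', ‖G p p'‖ ^ 2 + (s₀ * N / 4) ^ 4 * ∑ p, ∑ p', ‖((fwdDiff (fun _ : Fin 1 => (1 : ZMod N)))^[2] (fun q => G q p')) p‖ ^ 2 +
          ∑ i ∈ (univ : Finset (Fin 2)), (Λ₀ * L / 4) ^ 4 *
            ∑ p, ∑ p', ‖((fwdDiff (Pi.single i (1 : ZMod L) : TorusSite 2 L))^[2] (G p)) p'‖ ^ 2)) ≤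
        N * Qtot / (β * Λ₀) := by
      have hs₀N : s₀ * N / 4 = Λ₀ * β / 4 := by rw [hs₀]; field_simp
      rw [hs₀N, pow_one]
      -- each of the three kinds of terms is at most `constant/(β L² Λ₀)`
      have hT0 : ∑ p, ∑ p', ‖G p p'‖ ^ 2 ≤ 10 / (β * (L : ℝ) ^ 2 * Λ₀) := hE0.trans (plain_eq hΛ₀ hβ hL0).le
      have hT1 : (Λ₀ * β / 4) ^ 4 * ∑ p, ∑ p', ‖((fwdDiff (fun _ : Fin 1 => (1 : ZMod N)))^[2] (fun q => G q p')) p‖ ^ 2 ≤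
          ((2 * Real.pi) ^ 4 * K₅ ^ 2 / 512 + 1) / (β * (L : ℝ) ^ 2 * Λ₀) := by
        refine (mul_le_mul_of_nonneg_left hE1 (by positivity)).trans ?_
        rw [mul_add, add_div]
        exact add_le_add (interior_time_eq hΛ₀ hβ hL0).le (edge_time_le hΛ₀ hβ hL0 hM' hMβ)
      have hT2 : ∀ i : Fin 2, (Λ₀ * L / 4) ^ 4 * ∑ p, ∑ p', ‖((fwdDiff (Pi.single i (1 : ZMod L) : TorusSite 2 L))^[2] (G p)) p'‖ ^ 2 ≤
          ((2 * Real.pi) ^ 4 * K' ^ 2 / 512) / (β * (L : ℝ) ^ 2 * Λ₀) := fun i =>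
        (mul_le_mul_of_nonneg_left (hE2 i) (by positivity)).trans (space_eq hΛ₀ hβ hL0).le
      have hsum : ∑ p, ∑ p', ‖G p p'‖ ^ 2 + (Λ₀ * β / 4) ^ 4 * ∑ p, ∑ p', ‖((fwdDiff (fun _ : Fin 1 => (1 : ZMod N)))^[2] (fun q => G q p')) p‖ ^ 2 +
          ∑ i ∈ (univ : Finset (Fin 2)), (Λ₀ * L / 4) ^ 4 *
            ∑ p, ∑ p', ‖((fwdDiff (Pi.single i (1 : ZMod L) : TorusSite 2 L))^[2] (G p)) p'‖ ^ 2 ≤ Qtot / (β * (L : ℝ) ^ 2 * Λ₀) := by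
        have h2 : ∑ i ∈ (univ : Finset (Fin 2)), (Λ₀ * L / 4) ^ 4 *
            ∑ p, ∑ p', ‖((fwdDiff (Pi.single i (1 : ZMod L) : TorusSite 2 L))^[2] (G p)) p'‖ ^ 2 ≤
            2 * (((2 * Real.pi) ^ 4 * K' ^ 2 / 512) / (β * (L : ℝ) ^ 2 * Λ₀)) := by
          refine (sum_le_sum fun i _ => hT2 i).trans (le_of_eq ?_)
          rw [sum_const, card_univ, Fintype.card_fin, nsmul_eq_mul, Nat.cast_ofNat]
        calc _ ≤ 10 / (β * (L : ℝ) ^ 2 * Λ₀) + ((2 * Real.pi) ^ 4 * K₅ ^ 2 / 512 + 1) / (β * (L : ℝ) ^ 2 * Λ₀) +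
            2 * (((2 * Real.pi) ^ 4 * K' ^ 2 / 512) / (β * (L : ℝ) ^ 2 * Λ₀)) := add_le_add (add_le_add hT0 hT1) h2
          _ = Qtot / (β * (L : ℝ) ^ 2 * Λ₀) := by rw [hQtot]; field_simp; ring
      calc (N : ℝ) * (L : ℝ) ^ 2 * _ ≤ (N : ℝ) * (L : ℝ) ^ 2 * (Qtot / (β * (L : ℝ) ^ 2 * Λ₀)) :=
            mul_le_mul_of_nonneg_left hsum (by positivity)
        _ = N * Qtot / (β * Λ₀) := by field_simp
    -- assemble
    have hPQ : Real.sqrt (∑ a : TorusSite 1 N, ∑ b : TorusSite 2 L,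
        (1 + (s₀ * |(((a 0).valMinAbs : ℤ) : ℝ)|) ^ 4 + ∑ i, (Λ₀ * |(((b i).valMinAbs : ℤ) : ℝ)|) ^ 4)⁻¹) *
        Real.sqrt ((N : ℝ) ^ 1 * (L : ℝ) ^ 2 *
          (∑ p, ∑ p', ‖G p p'‖ ^ 2 + (s₀ * N / 4) ^ 4 * ∑ p, ∑ p', ‖((fwdDiff (fun _ : Fin 1 => (1 : ZMod N)))^[2] (fun q => G q p')) p‖ ^ 2 +
            ∑ i ∈ (univ : Finset (Fin 2)), (Λ₀ * L / 4) ^ 4 *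
              ∑ p, ∑ p', ‖((fwdDiff (Pi.single i (1 : ZMod L) : TorusSite 2 L))^[2] (G p)) p'‖ ^ 2)) ≤
        Real.sqrt (2744 * N / (β * Λ₀ ^ 3)) * Real.sqrt (N * Qtot / (β * Λ₀)) :=
      mul_le_mul (Real.sqrt_le_sqrt hP) (Real.sqrt_le_sqrt hQ) (Real.sqrt_nonneg _) (Real.sqrt_nonneg _)
    rw [hC]
    exact hPQ.trans (sqrt_assembly hΛ₀ hβ hN0 hQtot0).le
  refine ⟨fun X => ?_, fun Y => ?_⟩
  · rw [hubbardCovTopShifted_add_uv_eq_normalCovariance]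
    exact sum_norm_gridSub_pullback_row_le hβ.ne' hMN _ hA X
  · rw [hubbardCovTopShifted_add_uv_eq_normalCovariance]
    exact sum_norm_gridSub_pullback_col_le hβ.ne' hMN _ hA Y

end Literature.MathematicalPhysics.QuantumLattice

end
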